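import Summits.BirchSwinnertonDyer.Rank1Residual.X12.RamifiedSelmerCardRoute
import HarnessLib

/-!
# O11 at `p = 7`, ROUTE U (the UNIT CASE): typed inputs and PROVED consumers — `BSD(E,7)`, hence
# FULL BSD, for a 𝒞₇ member from (U-D) `#Sel⁷(E/ℚ) ∣ 7` and (U-A) `ord₇ #Ш_an(E) = 0`

HONEST FRAMING (cell `bsd-cm`, run/shared/lean/pub/bsd-cm/, verbatim): the programme isolates, for
CM elliptic curves over `ℚ` of analytic rank `≤ 1`, classes on which the FULL BSD formula is
reduced — strictly by PUBLISHED theorems entering as named-fact binders — to ONE local problem at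
ONE prime, and then TYPES that residual problem. This file (seat `bsd-cm-ram`, generation 2) types
the two per-curve inputs of ROUTE U of the seat's memo `HOME/bsd-cm-ram/ROUTE-U.md` (frozen
2026-08-25) and PROVES their consumers. NOTHING is asserted about any curve; no label moves; the
O11 CONSTRUCTION (the ramified Perrin-Riou/BDP formula (★_an), file `RamifiedStrictDescent.lean`)
is untouched — Route U is the UNIT CASE only (generator not `7`-divisible in `E(ℚ₇)`, `7 ∤ #Ш`).

## Route U in one paragraph (memo §0–§6)

`E_D = 49a1^{(D)}` (CM by `ℤ[(1+√−7)/2]`, `D < 0` odd fundamental, `7 ∤ D`), `K'' = ℚ(√d'')` an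
auxiliary imaginary quadratic field in which `7` and every prime of `D` SPLIT (`d''` odd `< −4`,
`(d'', 7D) = 1`). The `ℚ`-rational `7`-isogeny `E_D → E_D^{(−7)}` makes `7` an EISENSTEIN prime:
`E_D[7]^{ss} ≅ 𝔽₇(ω²χ_D) ⊕ 𝔽₇(ω⁵χ_D)`. Put `β₁ = B_{1,ω⁴χ_D}`, `β₂ = B_{1,ωχ_Dχ_{d''}}` (generalised
Bernoulli numbers, `ω` the mod-`7` Teichmüller character). THEOREM U (memo §2, a PAPER theorem of the
memo until refereed): if `7 ∤ β₁β₂` then (U-D) `Sel⁷(E_D/ℚ) ≅ ℤ/7` [the `7`-isogeny descent of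
memo §4: Kummer count over `ℚ(μ₇,√D)`, Stickelberger's theorem for the odd piece `ω²χ_D` — whose
annihilator is exactly `β₁` —, Leopoldt's reflection for the even piece, Schaefer–Stoll; cell b2b's
x1b memo EISENSTEIN-DESCENT.md re-derived and completed] and (U-A) `ord₇ #Ш_an(E_D) = 0` [Kriz–Li,
Forum Math. Sigma 7 (2019) e15, Thm. 7.1 (= arXiv:1609.06687 Thm. 2.1: the `7`-adic logarithm of the
Heegner point `P_{K''}` is a unit in the differential `ω_f = ω_Néron/c_Φ`; all hypotheses of Thm. 7.1
are vacuous here because both isogeny characters are ramified at `7` and at the primes of `D`; the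
additive-`p` case is the one Kriz–Li use for their Thm. 1.23) + Gross–Zagier WITH the constant `c_Φ`
of the parametrisation (tree `gross_zagier`, bookkeeping of `X11b.bsdp_of_indexIdentityAt`) + the
rank-`0` theorem for the twist `E_D^{(Dd'')}` (tree `bsdTriple_of_hasCM_of_L_one_ne_zero`) + the
descent for the twist (annihilator `β₂`) and for the generator level `n(D) = 0`; the constant `c_Φ`
CANCELS: `ord₇ #Ш_an(E_D) = 2(ord₇ c_Φ − n) − 2·ord₇ c_Φ − ord₇ #Ш(E_D^{(Dd'')}) = 0`]. This file:
(U-D) ∧ (U-A) ⇒ `BSDp E 7` (the tree's per-pair certificate shape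
`X12.bsdp_of_classX12_of_card_selmerGroup_dvd`, composed by name); on 𝒞₇ this is full BSD by
`ClassCSeven.forall_bsdp_iff_bsdp_seven` (p396430; sequel file). Numerics (kit j237665, pre-registered
HOME/bsd-cm-ram/PREREG-U1.md): `7 ∤ β₁β₂` holds, with an explicit `d''`, for ALL 54 members of 𝒞₇
with `|D| ≤ 1500` whose generator has `7`-level `0`, and `7 ∣ β₁` for all 15 members with positive
level (P-ram-U1 PASS 15/15) — evidence, nothing booked.

## Contents

* `RouteU.SelmerSevenBound W` — (U-D): `#Sel⁷(E/ℚ) ∣ 7` (a PREDICATE on `W`; nothing asserted).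
* `RouteU.ShaAnSevenUnit W` — (U-A): `#Ш_an(E) = q ∈ ℚ` with `ord₇ q = 0` (a PREDICATE).
* `RouteU.bsdp_seven` — (U-D) ∧ (U-A) at a CM curve with `d_K = −7` and `r_an = 1` ⇒ `BSDp W 7`
  (GZK binder `hGZK`); `RouteU.missingPPartAt_seven` — the typed residue `Typed.MissingPPartAt W 7`.
  The 𝒞₇ corollary ((U-D) ∧ (U-A) ⇒ FULL BSD via `ClassCSeven.forall_bsdp_iff_bsdp_seven`, p396430)
  is the sequel file `RouteUSevenFullBSD.lean`.

OWED (memo §10 K-c): the named fact `KrizLi2019.thm71_…` in the currency of the tree's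
`KrizLi2019.thm116_padicLogHeegner_congruence`, the elementary `mod 49` form of `7 ∤ β₁β₂`, and a
Manin-carrying variant of `X11b.bsdp_of_indexIdentityAt`; with them (U-A) becomes a kernel theorem
from (U-D)-type inputs. References: [KrizLi2019] Thm. 7.1, Rem. 1.21, Thm. 1.23/10.10, §10.3;
[GrossZagier1986] V.§2; [Washington1997] Thms. 6.10, 10.9; [SchaeferStoll2004] Lemma 6.1;
[Rubin1991MainConj] Thm. 11.1; [BurungaleFlach2024] Cor. 2; [Miller2011LMS] Def. 1.1;
Česnavičius–Neururer–Saha (JEMS; arXiv:1911.09446) Thm. 1.2 (Manin constant vs modular degree).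
-/

noncomputable section

open scoped Classical

open WeierstrassCurve Literature.NumberTheory.EllipticCurves
  Literature.NumberTheory.EllipticCurves.Rank1Residual
  Literature.NumberTheory.EllipticCurves.Rank1Residual.Typed

namespace Summit.BirchSwinnertonDyer.Rank1Residual.X12.O11.RouteU

variable (W : WeierstrassCurve ℚ) [W.IsElliptic]

/-- **(U-D) — the descent input of Route U at `7`:** `#Sel⁷(E/ℚ) ∣ 7`, i.e. `dim_𝔽₇ Sel⁷(E/ℚ) ≤ 1`
(the `7`-Selmer group is finite of order `1` or `7`). For `E = 49a1^{(D)}` it is PROVED ON PAPER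
(memo ROUTE-U §4, Prop. D(a): Kummer count over `ℚ(μ₇,√D)`, Stickelberger, Leopoldt reflection,
Schaefer–Stoll) under `7 ∤ β₁(D) = B_{1,ω⁴χ_D}`; it is also cell b2b's per-pair Eisenstein-descent
certificate line (`X12/RamifiedSelmerCardRoute.lean`). A predicate; nothing asserted.
[cite: KrizLi2019, §10.3 (shape of the 3-descent at an additive Eisenstein prime)]
[cite: SchaeferStoll2004, Lemma 6.1] -/
@[conjecture] def SelmerSevenBound : Prop :=
  Nat.card (W.selmerGroup (7 : ℤ)) ∣ 7

/-- **(U-A) — the analytic input of Route U at `7`:** Miller's analytic order of `Ш` is a rational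
number of `7`-adic valuation `0`: `#Ш_an(E) = q ∈ ℚ`, `ord₇ q = 0`. For `E = 49a1^{(D)}` it is PROVED
ON PAPER (memo ROUTE-U §3, §5, §6) under `7 ∤ β₁(D)·β₂(D,d'')` from Kriz–Li 2019 Thm. 7.1 (the
`7`-adic logarithm of the Heegner point over the auxiliary field `K''` is a unit in `ω_f`),
Gross–Zagier with the parametrisation constant carried (it cancels), the rank-`0` theorem for the
`K''`-twist and the descent of §4 (twist and generator level); IN THE KERNEL, granted the named facts
`gross_zagier`/`kolyvagin`/GZK/modularity and a Heegner datum, it is the output of the seat's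
`O11.bsdp_of_heegnerIndexVal_eq_maninVal` (file `X12/O11/HeegnerIndexManinDescent.lean`) from the
finer inputs `ord₇[E(K''):ℤP] = ord₇ c`, `7 ∤ ∏c_ℓ`, `7 ∤ #Ш(E)`, `7 ∤ #Ш(E^{d''})`. A predicate;
nothing asserted.
[cite: KrizLi2019, Thm. 7.1 and Rem. 1.21] [cite: GrossZagier1986, V.§2] [cite: Miller2011LMS, §1] -/
@[conjecture] def ShaAnSevenUnit : Prop :=
  ∃ q : ℚ, shaAn W = (q : ℂ) ∧ padicValRat 7 q = 0

/-- `7` is prime. [folklore] -/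
instance fact_prime_seven : Fact (Nat.Prime 7) := ⟨by norm_num⟩

/-- **ROUTE U ⇒ `BSD(E,7)`.** For a CM curve `W/ℚ` with CM field `ℚ(√−7)` (`d_K = −7`, so `7` is the
ramified prime: an X12 pair, `E[7]` reducible) and `ord_{s=1} L(E,s) = 1`: the inputs (U-D)
`#Sel⁷(E/ℚ) ∣ 7` and (U-A) `ord₇ #Ш_an = 0` give Miller's `BSD(E,7)` — by the tree's per-pair
certificate shape `X12.bsdp_of_classX12_of_card_selmerGroup_dvd` (GZK `hGZK`: rank `1`, `Ш` finite;
`#Sel⁷ = 7` forces `Ш(E/ℚ)[7] = 0`). For `W = 49a1^{(D)}` both inputs follow ON PAPER from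
`7 ∤ β₁(D)β₂(D,d'')` (Theorem U of the memo). [cite: Miller2011LMS, §1 and Def. 1.1]
[cite: KrizLi2019, Thm. 7.1 and Rem. 1.21] -/
theorem bsdp_seven (hGZK : rank_eq_analyticRank_of_analyticRank_le_one) (hcm : W.HasCM)
    (hK : cmFieldDiscrOfJ W.j = -7) (hr : W.analyticRank = 1)
    (hD : SelmerSevenBound W) (hA : ShaAnSevenUnit W) : BSDp W 7 := by
  obtain ⟨q, hq, hv⟩ := hA
  have hram : CMRamified W 7 := by rw [CMRamified, hK]; norm_num
  have hX : ClassX12 W 7 := ⟨hcm, hr, Or.inr (Or.inr (Or.inl hram))⟩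
  exact bsdp_of_classX12_of_card_selmerGroup_dvd hGZK W 7 hX hq hv hD

/-- … and the cell's typed residue at `7`, `Typed.MissingPPartAt W 7` (`#Ш_an ∈ ℚ` with
`ord₇ #Ш_an = ord₇ #Ш(E/ℚ)`), holds at such a curve (`BSD(E,7)` ⇒ `MissingPPartAt`, `Ш` finite by
GZK). The 𝒞₇ corollary (full BSD via `ClassCSeven.forall_bsdp_iff_bsdp_seven`, p396430) is filed
separately (`RouteUSevenFullBSD.lean`). [cite: Miller2011LMS, Def. 1.1] -/
theorem missingPPartAt_seven (hGZK : rank_eq_analyticRank_of_analyticRank_le_one) (hcm : W.HasCM)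
    (hK : cmFieldDiscrOfJ W.j = -7) (hr : W.analyticRank = 1)
    (hD : SelmerSevenBound W) (hA : ShaAnSevenUnit W) : Typed.MissingPPartAt W 7 := by
  haveI : Finite W.sha := (hGZK W (by rw [hr])).2
  exact missingPPartAt_of_bsdp W 7 (bsdp_seven W hGZK hcm hK hr hD hA)

end Summit.BirchSwinnertonDyer.Rank1Residual.X12.O11.RouteU

end
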